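/-
Copyright (c) 2026 the pub-hodgecm-mathlib formalisation cell (harness21).  Prover seat hodgecm-mathlib-F0P3a-p03 (g8), topic T5 = P8
«(C♯)hol interior», row «Cc (3′)» brick δ (second hand of A-p19 (g19), desk F0P2-plan (g8)), 2026-08-31.
KERNEL module: THEOREMS ONLY (no definition, no named fact, no `sorry`, no instance, no notation).
-/
import Literature.NumberTheory.Weil1964.ArchPlaceCompactSliceCharacter
import Literature.Analysis.SegalBargmann.FockPkIrreducible
import Mathlib.Analysis.LocallyConvex.SeparatingDual
import HarnessLib

/-!
# A continuous linear map on `𝓢(ℝ^{ι × o})` that is `det^m`-COVARIANT (`m ≠ 0`) under the unitary block at ONE place vanishes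

Topic `NumberTheory/Weil1964`; namespace `Literature.NumberTheory.Weil1964` (that of ★ `ArchPlaceCompactSliceCharacter`, whose
`placeBlock (Pi.mulSingle v A)` / place-free-polynomial vocabulary this file continues).  KERNEL: theorems only.  Cell
hodgecm-mathlib FLOOR 0, programme P2, topic T5 = P8 «(C♯)hol interior», node Cc = [Liu2021, Lem. D.2 (1)] at a definite place:
brick δ — the ANALYTIC HEART — of A-p19 (g19)'s (3′) assembly (`F0/P2/A-p19/g19/cc/ROAD-Cc-3prime.A-p19g19.md`).

THE STATEMENT (`eq_zero_of_forall_unitaryOpPi_placeBlock_mulSingle`).  Let `ι` (`|ι| ≥ 2`) index the variables of one archimedean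
place and `o` the places, so the Schwartz space is `𝓢(ℝ^{ι × o})` and `U(ι)` acts at the place `v` through the metaplectic operators
`unitaryOpPi (placeBlock (Pi.mulSingle v A))` (★ `SchwartzUnitaryIdentification`, ★ `ArchFollandCompact`).  If a continuous linear
`T : 𝓢(ℝ^{ι × o}) →L[ℂ] X` into a normed space satisfies `T (μ₀(A at v) f) = det(A)^m • T f` for all `A ∈ U(ι)` and some integer `m ≠ 0`,
then `T = 0`.

THE PROOF (Folland's Fock model, everything ★).  By ★ `clm_eq_of_eq_on_hermitePi` it suffices to kill the Hermite functions
`h_β = B⁻¹ζ_β` (★ `binvPi_zeta`); a monomial on `ι × o` is `(z^{β₁} at v) · z^{β_off}` with `z^{β_off}` free of the place `v` (§4).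
* degree `0` at `v` (§2): a place-`v`-free `B⁻¹G` is FIXED by every `μ₀(A at v)` (★ `unitaryOpPi_placeBlock_mulSingle_binvPi`), so
  `T(B⁻¹G) = det(A)^m • T(B⁻¹G)`, and `A = diag(e^{iπ/m}, 1, …, 1)` has `det(A)^m = −1 ≠ 1` (§1);
* degree `k ≥ 1` at `v` (§3): after a functional `φ ∈ X*` (Hahn–Banach, `SeparatingDual.eq_zero_of_forall_dual_eq_zero`) the map
  `Λ : p ↦ φ(T(B⁻¹((p at v) · Q)))` on `ℂ[z_ι]` satisfies `Λ(p ∘ A⁻¹) = det(A)^m Λ(p)` (★ `unitaryOpPi_binvPi`, ★ `linSubst_blockDiagonal_mulSingle`,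
  ★ `placeMap_rename_same` / `placeMap_eq_self_of_vars`), so the image in Fock space of `ker Λ ∩ 𝓗_k` is a `U(ι)`-stable subspace of `𝓟_k`
  (★ `fockRep_fockToL2`, ★ `isHomogeneous_linSubst`); by IRREDUCIBILITY of `𝓟_k` (★ `degSpan_singleton_irreducible`, [Folland1989, Ch. 4 §5])
  it is `𝓟_k` — whence `Λ = 0` on `𝓗_k` (★ `fockToL2_injective`) — or `0`, which is absurd since `𝓗_k ↪ ℂ` cannot be injective on the two
  monomials `z_i^k`, `z_j^k` (`i ≠ j`, `k ≥ 1`).  (The sibling ★ `FockCovariantFunctional` (A-p19) reaches the same kill through the Riesz vector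
  and [Folland1989, Prop. (4.76)].)

* `exists_unitaryGroup_det_zpow_ne_one` (§1) · `apply_binvPi_eq_zero_of_vars` (§2, δ₀) · `apply_binvPi_rename_atPlace_mul_eq_zero` (§3, δₖ) ·
  `exists_monomial_eq_rename_atPlace_mul` (§4) · **`eq_zero_of_forall_unitaryOpPi_placeBlock_mulSingle`** (§5) · the Hermite-basis form
  `forall_apply_unitaryOpPi_placeBlock_mulSingle_of_hermitePi` ∕ **`eq_zero_of_forall_unitaryOpPi_placeBlock_mulSingle_hermitePi`** (§6).

HONEST SCOPE.  Pure archimedean analysis in the Fock/Schwartz model; nothing of [Liu2021] is asserted.  HC_CM is proved only modulo the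
printed citations until rung 0 closes; this file books nothing and discharges nothing booked.

## References
* [Folland1989] G. B. Folland, *Harmonic Analysis in Phase Space*, Princeton UP (1989), §1.7 (Hermite/Fock bases), Prop. (4.39)
  (the metaplectic action of `U(n)`), Ch. 4 §5 («each `𝓟_k` is irreducible»), Prop. (4.76).
* [KashiwaraVergne1978] M. Kashiwara, M. Vergne, Invent. Math. 44 (1978), §II (5.1)–(5.5) (`K`-types of the Weil representation of a compact pair).
* [Liu2021] Y. Liu, Camb. J. Math. 9 (2021), App. D Lem. D.2 (1) (l. 5283) — the consumer.
-/

set_option autoImplicit false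

noncomputable section

open Complex SchwartzMap Matrix MvPolynomial
open Literature.Analysis.SegalBargmann Literature.RepresentationTheory

namespace Literature.NumberTheory.Weil1964

variable {ι : Type} [Fintype ι] [DecidableEq ι] {o : Type} [Fintype o] [DecidableEq o]
  {X : Type*} [NormedAddCommGroup X] [NormedSpace ℂ X]

/-! ## §1 A unitary at one place whose `det^m` is not `1` -/

omit [DecidableEq ι] in
/-- for `m ≠ 0` the diagonal unitary `diag(e^{iπ/m} at i₀, 1 elsewhere)` has `det^m = e^{iπ} = −1 ≠ 1`. [cite: Folland1989, Prop (4.39)] -/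
theorem exists_unitaryGroup_det_zpow_ne_one [DecidableEq ι] [Nonempty ι] {m : ℤ} (hm : m ≠ 0) :
    ∃ A : Matrix.unitaryGroup ι ℂ, ((A : Matrix ι ι ℂ).det) ^ m ≠ 1 := by
  obtain ⟨i₀⟩ := ‹Nonempty ι›
  refine ⟨diagHom (Function.update (fun _ => (1 : Circle)) i₀ (Circle.exp (Real.pi / m))), ?_⟩
  have hprod : (∏ l, ((Function.update (fun _ => (1 : Circle)) i₀ (Circle.exp (Real.pi / m)) l : Circle) : ℂ)) =
      Complex.exp (((Real.pi / m : ℝ) : ℂ) * Complex.I) := by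
    rw [Finset.prod_eq_single i₀]
    · rw [Function.update_self, Circle.coe_exp]
    · intro l _ hl
      rw [Function.update_of_ne hl, Circle.coe_one]
    · exact fun h => (h (Finset.mem_univ _)).elim
  rw [coe_diagHom, Matrix.det_diagonal, hprod, ← Complex.exp_int_mul]
  have harg : (m : ℂ) * ((((Real.pi / m : ℝ)) : ℂ) * Complex.I) = Real.pi * Complex.I := by
    have hm' : (m : ℂ) ≠ 0 := Int.cast_ne_zero.mpr hm
    rw [Complex.ofReal_div, Complex.ofReal_intCast]
    field_simp
  rw [harg, Complex.exp_pi_mul_I]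
  norm_num

/-! ## §2 Degree `0` at the place: the place-`v`-free vectors are killed (δ₀) -/

/-- **(δ₀)** if `T (μ₀(A at v) f) = det(A)^m • T f` for all `A ∈ U(ι)` (`m ≠ 0`), then `T (B⁻¹G) = 0` for every polynomial `G` free of the
place `v` — such `B⁻¹G` are fixed by every `μ₀(A at v)` (★ `unitaryOpPi_placeBlock_mulSingle_binvPi`), and some `det(A)^m ≠ 1` (§1).
[cite: Folland1989, Prop (4.39)] [cite: KashiwaraVergne1978, §II (5.1)–(5.5)] -/
theorem apply_binvPi_eq_zero_of_vars [Nonempty ι] (v : o) (T : SchwartzMap ((ι × o) → ℝ) ℂ →L[ℂ] X) {m : ℤ} (hm : m ≠ 0)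
    (hT : ∀ (A : Matrix.unitaryGroup ι ℂ) (f : SchwartzMap ((ι × o) → ℝ) ℂ),
      T (unitaryOpPi (placeBlock (Pi.mulSingle v A)) f) = (((A : Matrix ι ι ℂ).det) ^ m) • T f)
    {G : MvPolynomial (ι × o) ℂ} (hG : ∀ x ∈ G.vars, x.2 ≠ v) : T (binvPi G) = 0 := by
  obtain ⟨A, hA⟩ := exists_unitaryGroup_det_zpow_ne_one (ι := ι) hm
  have h := hT A (binvPi G)
  rw [unitaryOpPi_placeBlock_mulSingle_binvPi v A hG] at h
  have h2 : (1 - ((A : Matrix ι ι ℂ).det) ^ m) • T (binvPi G) = 0 := by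
    rw [sub_smul, one_smul, ← h, sub_self]
  rcases smul_eq_zero.mp h2 with h3 | h3
  · exact absurd (sub_eq_zero.mp h3).symm hA
  · exact h3

/-! ## §3 Degree `k ≥ 1` at the place: killed by the irreducibility of `𝓟_k` (δₖ) -/

/-- **(δₖ)** if `T (μ₀(A at v) f) = det(A)^m • T f` for all `A ∈ U(ι)` and `|ι| ≥ 2`, then `T (B⁻¹((p at v) · Q)) = 0` for every HOMOGENEOUS
`p ∈ ℂ[z_ι]` of degree `k ≥ 1` and every `Q` free of the place `v`: after a functional `φ ∈ X*` the map `Λ : p ↦ φ(T(B⁻¹((p at v)·Q)))` satisfies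
`Λ(p ∘ A⁻¹) = det(A)^m Λ(p)`, so `fockToL2 (ker Λ ∩ 𝓗_k)` is a `U(ι)`-stable subspace of `𝓟_k`, hence `𝓟_k` (⇒ `Λ|_{𝓗_k} = 0`) or `0`
(absurd: `z_i^k`, `z_j^k` would both inject into `ℂ`) by Folland's irreducibility of `𝓟_k`. [cite: Folland1989, Ch. 4 §5] [cite: Folland1989, Prop (4.76)]
[cite: KashiwaraVergne1978, §II (5.1)–(5.5)] -/
theorem apply_binvPi_rename_atPlace_mul_eq_zero [Nontrivial ι] (v : o) (T : SchwartzMap ((ι × o) → ℝ) ℂ →L[ℂ] X) {m : ℤ}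
    (hT : ∀ (A : Matrix.unitaryGroup ι ℂ) (f : SchwartzMap ((ι × o) → ℝ) ℂ),
      T (unitaryOpPi (placeBlock (Pi.mulSingle v A)) f) = (((A : Matrix ι ι ℂ).det) ^ m) • T f)
    {k : ℕ} (hk : k ≠ 0) {p : MvPolynomial ι ℂ} (hp : p.IsHomogeneous k)
    {Q : MvPolynomial (ι × o) ℂ} (hQ : ∀ x ∈ Q.vars, x.2 ≠ v) :
    T (binvPi (rename (atPlace v) p * Q)) = 0 := by
  refine SeparatingDual.eq_zero_of_forall_dual_eq_zero (R := ℂ) fun φ => ?_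
  -- the scalar functional on `ℂ[z_ι]`
  set Λ : MvPolynomial ι ℂ →ₗ[ℂ] ℂ :=
    ((φ : X →L[ℂ] ℂ) : X →ₗ[ℂ] ℂ) ∘ₗ ((T : SchwartzMap ((ι × o) → ℝ) ℂ →ₗ[ℂ] X) ∘ₗ (binvPiₗ ∘ₗ
      (LinearMap.mulRight ℂ Q ∘ₗ (rename (atPlace (κ := ι) v) : MvPolynomial ι ℂ →ₐ[ℂ] MvPolynomial (ι × o) ℂ).toLinearMap)))
    with hΛdef
  have hΛ : ∀ q : MvPolynomial ι ℂ, Λ q = φ (T (binvPi (rename (atPlace v) q * Q))) := fun q => rfl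
  -- covariance of `Λ` under the Bargmann substitution
  have hcov : ∀ (A : Matrix.unitaryGroup ι ℂ) (q : MvPolynomial ι ℂ),
      Λ (linSubst (star (A : Matrix ι ι ℂ)) q) = (((A : Matrix ι ι ℂ).det) ^ m) * Λ q := by
    intro A q
    have hsub : linSubst (star ((placeBlock (Pi.mulSingle v A) : Matrix.unitaryGroup (ι × o) ℂ) : Matrix (ι × o) (ι × o) ℂ))
          (rename (atPlace v) q * Q) = rename (atPlace v) (linSubst (star (A : Matrix ι ι ℂ)) q) * Q := by
      rw [star_coe_placeBlock_mulSingle, linSubst_blockDiagonal_mulSingle, map_mul, placeMap_rename_same,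
        placeMap_eq_self_of_vars v _ hQ]
    rw [hΛ, hΛ, ← hsub, ← unitaryOpPi_binvPi, hT, map_smul, smul_eq_mul]
  -- the `U(ι)`-stable subspace `fockToL2 (ker Λ ∩ 𝓗_k) ≤ 𝓟_k`
  set W : Submodule ℂ (FockL2 ι) := (LinearMap.ker Λ ⊓ MvPolynomial.homogeneousSubmodule ι ℂ k).map fockToL2 with hWdef
  have hmemW : ∀ q : MvPolynomial ι ℂ, q.IsHomogeneous k → Λ q = 0 → fockToL2 q ∈ W := fun q hqh hq0 =>
    Submodule.mem_map.mpr ⟨q, Submodule.mem_inf.mpr ⟨LinearMap.mem_ker.mpr hq0, (MvPolynomial.mem_homogeneousSubmodule k q).mpr hqh⟩, rfl⟩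
  have hdeg : ∀ q : MvPolynomial ι ℂ, q.IsHomogeneous k → fockToL2 q ∈ degSpan (σ := ι) ({k} : Set ℕ) := fun q hqh =>
    fockToL2_mem_degSpan fun γ hγ => Set.mem_singleton_iff.mpr (mdeg_eq_of_mem_support_of_isHomogeneous hqh hγ)
  have hWk : W ≤ degSpan (σ := ι) ({k} : Set ℕ) := by
    intro x hx
    obtain ⟨q, hq, rfl⟩ := Submodule.mem_map.mp hx
    exact hdeg q ((MvPolynomial.mem_homogeneousSubmodule k q).mp (Submodule.mem_inf.mp hq).2)
  have hW : ∀ U : Matrix.unitaryGroup ι ℂ, ∀ x ∈ W, fockRep U x ∈ W := by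
    intro U x hx
    obtain ⟨q, hq, rfl⟩ := Submodule.mem_map.mp hx
    obtain ⟨hqk, hqh⟩ := Submodule.mem_inf.mp hq
    rw [fockRep_fockToL2]
    refine hmemW _ (isHomogeneous_linSubst _ ((MvPolynomial.mem_homogeneousSubmodule k q).mp hqh)) ?_
    rw [hcov, LinearMap.mem_ker.mp hqk, mul_zero]
  -- every homogeneous `q` of degree `k` lies in `ker Λ`
  have hker : ∀ q : MvPolynomial ι ℂ, q.IsHomogeneous k → Λ q = 0 := by
    rcases degSpan_singleton_irreducible k W hWk hW with hbot | htop
    · -- `W = 0`: then `Λ` would be injective on `𝓗_k`, impossible for `k ≥ 1`, `|ι| ≥ 2`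
      exfalso
      have hzero : ∀ q : MvPolynomial ι ℂ, q.IsHomogeneous k → Λ q = 0 → q = 0 := by
        intro q hqh hq0
        have hmem := hmemW q hqh hq0
        rw [hbot, Submodule.mem_bot] at hmem
        exact fockToL2_injective (by rw [hmem, map_zero])
      obtain ⟨i, j, hij⟩ := exists_pair_ne ι
      have h₁ : (monomial (Finsupp.single i k) (1 : ℂ) : MvPolynomial ι ℂ).IsHomogeneous k :=
        isHomogeneous_monomial _ (by rw [degree_eq_mdeg, mdeg_single])
      have h₂ : (monomial (Finsupp.single j k) (1 : ℂ) : MvPolynomial ι ℂ).IsHomogeneous k :=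
        isHomogeneous_monomial _ (by rw [degree_eq_mdeg, mdeg_single])
      set a : ℂ := Λ (monomial (Finsupp.single i k) 1) with ha
      set b : ℂ := Λ (monomial (Finsupp.single j k) 1) with hb
      have hq : (b • (monomial (Finsupp.single i k) (1 : ℂ) : MvPolynomial ι ℂ) - a • monomial (Finsupp.single j k) 1).IsHomogeneous k :=
        (MvPolynomial.mem_homogeneousSubmodule k _).mp
          (Submodule.sub_mem _ (Submodule.smul_mem _ _ ((MvPolynomial.mem_homogeneousSubmodule k _).mpr h₁))
            (Submodule.smul_mem _ _ ((MvPolynomial.mem_homogeneousSubmodule k _).mpr h₂)))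
      have hΛq : Λ (b • (monomial (Finsupp.single i k) (1 : ℂ) : MvPolynomial ι ℂ) - a • monomial (Finsupp.single j k) 1) = 0 := by
        rw [map_sub, map_smul, map_smul, smul_eq_mul, smul_eq_mul, ← ha, ← hb, mul_comm, sub_self]
      have hq0 := hzero _ hq hΛq
      have hne : Finsupp.single j k ≠ Finsupp.single i k := fun h => hij ((Finsupp.single_left_injective hk) h).symm
      have hc := congrArg (coeff (Finsupp.single i k)) hq0
      rw [coeff_sub, coeff_smul, coeff_smul, coeff_monomial, coeff_monomial, if_pos rfl, if_neg hne, coeff_zero, smul_eq_mul,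
        smul_eq_mul, mul_one, mul_zero, sub_zero] at hc
      have h0 := hzero _ h₂ hc
      rw [monomial_eq_zero] at h0
      exact one_ne_zero h0
    · intro q hqh
      have hmem : fockToL2 q ∈ W := by rw [htop]; exact hdeg q hqh
      obtain ⟨q', hq', hqq'⟩ := Submodule.mem_map.mp hmem
      rw [← fockToL2_injective hqq']
      exact LinearMap.mem_ker.mp (Submodule.mem_inf.mp hq').1
  have h := hker p hp
  rwa [hΛ] at h

/-! ## §4 The one-place split of a monomial -/

omit [Fintype ι] [DecidableEq ι] [Fintype o] in
/-- **`z^β = (z^{β₁} at v) · z^{β_off}`** with `z^{β_off}` free of the place `v`: the monomial of `β : ι × o →₀ ℕ` splits along the variables of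
the place `v` (`Finsupp.filter` / `comapDomain` along `atPlace v = (·, v)`) and the rest. [cite: Folland1989, §1.7] -/
theorem exists_monomial_eq_rename_atPlace_mul (v : o) (β : (ι × o) →₀ ℕ) :
    ∃ (β₁ : ι →₀ ℕ) (βr : (ι × o) →₀ ℕ), (∀ x ∈ βr.support, x.2 ≠ v) ∧
      (monomial β (1 : ℂ) : MvPolynomial (ι × o) ℂ) = rename (atPlace v) (monomial β₁ 1) * monomial βr 1 := by
  classical
  have hinj : Function.Injective (atPlace (κ := ι) v) := fun a b h => (Prod.mk.inj h).1
  have hsup : (↑(β.filter fun x : ι × o => x.2 = v).support : Set (ι × o)) ⊆ Set.range (atPlace (κ := ι) v) := by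
    intro x hx
    have hx' : x ∈ (β.filter fun x : ι × o => x.2 = v).support := hx
    rw [Finsupp.support_filter, Finset.mem_filter] at hx'
    exact ⟨x.1, Prod.ext rfl hx'.2.symm⟩
  refine ⟨(β.filter fun x : ι × o => x.2 = v).comapDomain (atPlace v) hinj.injOn, β.filter fun x : ι × o => ¬ x.2 = v, ?_, ?_⟩
  · intro x hx
    rw [Finsupp.support_filter, Finset.mem_filter] at hx
    exact hx.2
  · rw [rename_monomial, Finsupp.mapDomain_comapDomain _ hinj _ hsup, monomial_mul, one_mul, Finsupp.filter_add_filter_not]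

/-! ## §5 The theorem -/

/-- **A `det^m`-COVARIANT CONTINUOUS LINEAR MAP ON `𝓢(ℝ^{ι × o})` VANISHES** (`m ≠ 0`, `|ι| ≥ 2`): if
`T (unitaryOpPi (placeBlock (Pi.mulSingle v A)) f) = det(A)^m • T f` for every `A ∈ U(ι)` and every Schwartz `f`, then `T = 0` — the
vacuum-type vectors at `v` are fixed by `U(ι)` but `det^m ≢ 1` (δ₀), every other `U(ι)`-type at `v` is killed by the irreducibility of the
Fock degree pieces (δₖ), and the Hermite functions are total in `𝓢` (★ `clm_eq_of_eq_on_hermitePi`).  This is the analytic heart of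
[Liu2021, Lem. D.2 (1)]: a `U(V_w)`-invariant theta functional at a definite place sees only the trivial `U(V_w)`-type.
[cite: Folland1989, Ch. 4 §5] [cite: Folland1989, Prop (4.39)] [cite: KashiwaraVergne1978, §II (5.1)–(5.5)] -/
theorem eq_zero_of_forall_unitaryOpPi_placeBlock_mulSingle [Nontrivial ι] (v : o) (T : SchwartzMap ((ι × o) → ℝ) ℂ →L[ℂ] X)
    {m : ℤ} (hm : m ≠ 0)
    (hT : ∀ (A : Matrix.unitaryGroup ι ℂ) (f : SchwartzMap ((ι × o) → ℝ) ℂ),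
      T (unitaryOpPi (placeBlock (Pi.mulSingle v A)) f) = (((A : Matrix ι ι ℂ).det) ^ m) • T f) :
    T = 0 := by
  refine clm_eq_of_eq_on_hermitePi fun β => ?_
  show T (hermitePi β) = 0
  rw [← binvPi_zeta, zeta, binvPi_smul, map_smul]
  obtain ⟨β₁, βr, hβr, hsplit⟩ := exists_monomial_eq_rename_atPlace_mul (ι := ι) v β
  rw [hsplit]
  have hQ : ∀ x ∈ (monomial βr (1 : ℂ) : MvPolynomial (ι × o) ℂ).vars, x.2 ≠ v := by
    intro x hx
    rw [vars_monomial one_ne_zero] at hx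
    exact hβr x hx
  by_cases hk : mdeg β₁ = 0
  · -- degree `0` at `v`: `β₁ = 0`, the monomial is free of `v`
    have hβ₁ : β₁ = 0 := Finsupp.ext fun l => Nat.eq_zero_of_le_zero (hk ▸ le_mdeg β₁ l)
    rw [hβ₁, ← C_apply, C_1, map_one, one_mul, apply_binvPi_eq_zero_of_vars v T hm hT hQ, smul_zero]
  · rw [apply_binvPi_rename_atPlace_mul_eq_zero v T hT hk (isHomogeneous_monomial _ (degree_eq_mdeg β₁)) hQ, smul_zero]

/-! ## §6 Covariance asked on the Hermite basis only (the shape met by the polynomial algebra of brick β) -/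

/-- **Covariance on the Hermite basis is covariance**: if `T (μ₀(A at v) h_β) = det(A)^m • T h_β` for every Hermite function `h_β`
(★ `hermitePi`), then the same holds for every Schwartz `f` — both sides are continuous linear in `f` and the `h_β` are total in `𝓢`
(★ `clm_eq_of_eq_on_hermitePi`). [cite: Folland1989, §1.7] [cite: Folland1989, Prop (4.39)] -/
theorem forall_apply_unitaryOpPi_placeBlock_mulSingle_of_hermitePi (v : o) (T : SchwartzMap ((ι × o) → ℝ) ℂ →L[ℂ] X) {m : ℤ}
    (hT : ∀ (A : Matrix.unitaryGroup ι ℂ) (β : (ι × o) →₀ ℕ),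
      T (unitaryOpPi (placeBlock (Pi.mulSingle v A)) (hermitePi β)) = (((A : Matrix ι ι ℂ).det) ^ m) • T (hermitePi β))
    (A : Matrix.unitaryGroup ι ℂ) (f : SchwartzMap ((ι × o) → ℝ) ℂ) :
    T (unitaryOpPi (placeBlock (Pi.mulSingle v A)) f) = (((A : Matrix ι ι ℂ).det) ^ m) • T f := by
  have h : T.comp (unitaryOpPi (placeBlock (Pi.mulSingle v A))) = (((A : Matrix ι ι ℂ).det) ^ m) • T :=
    clm_eq_of_eq_on_hermitePi fun β => by
      rw [ContinuousLinearMap.comp_apply, _root_.smul_apply, hT]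
  have h2 := congrArg (fun S : SchwartzMap ((ι × o) → ℝ) ℂ →L[ℂ] X => S f) h
  simpa only [ContinuousLinearMap.comp_apply, _root_.smul_apply] using h2

/-- **THE HERMITE-BASIS FORM** (A-p19 (g19)'s socket for the (3′) closer, where brick β supplies the covariance on `h_β` by pure polynomial
algebra): if `T (unitaryOpPi (placeBlock (Pi.mulSingle v A)) (hermitePi β)) = det(A)^m • T (hermitePi β)` for every `A ∈ U(ι)` and every
`β : ι × o →₀ ℕ` (`m ≠ 0`, `|ι| ≥ 2`), then `T = 0`. [cite: Folland1989, Ch. 4 §5] [cite: Folland1989, Prop (4.39)]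
[cite: KashiwaraVergne1978, §II (5.1)–(5.5)] -/
theorem eq_zero_of_forall_unitaryOpPi_placeBlock_mulSingle_hermitePi [Nontrivial ι] (v : o)
    (T : SchwartzMap ((ι × o) → ℝ) ℂ →L[ℂ] X) {m : ℤ} (hm : m ≠ 0)
    (hT : ∀ (A : Matrix.unitaryGroup ι ℂ) (β : (ι × o) →₀ ℕ),
      T (unitaryOpPi (placeBlock (Pi.mulSingle v A)) (hermitePi β)) = (((A : Matrix ι ι ℂ).det) ^ m) • T (hermitePi β)) :
    T = 0 :=
  eq_zero_of_forall_unitaryOpPi_placeBlock_mulSingle v T hm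
    (forall_apply_unitaryOpPi_placeBlock_mulSingle_of_hermitePi v T hT)

end Literature.NumberTheory.Weil1964

end
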